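import Mathlib
import HarnessLib
import HarnessLib.Audit
import Summits.ValiantsHypothesis.Statement
import Literature.Computability.AlgebraicComplexity.CircuitDepth
import Literature.Computability.AlgebraicComplexity.StandardFamiliesProofs
import Literature.Computability.AlgebraicComplexity.ValiantConjectureProofs
import HarnessLib.Audit.Status.Attr

/-!
Route: ChowBorderDepth3

DORMANT since 2026-08-24T10:53:24Z (reconciler: no traction for 6.7 d (last activity item-evidence-added at 2026-08-17T17:02:31Z); parked, not closed — `ledger route dormant route-ValiantsHypothesis-ChowBorderDepth3 --off` to reactivate) — unstaffed, not closed; items shared with open routes are served there. `ledger route dormant <id> --off` reactivates.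

# Route ChowBorderDepth3 — depth-three chasm via border Chow rank of the padded permanent,
torus-fixed witnesses

It suffices to show X = Depth3Thesis: for every c there is n such that no arithmetic circuit of
product-depth ≤ 1 (a ΣΠΣ
circuit: weighted sums of products of affine forms) with at most (n+2)^(c⌊√n⌋+c) WIRES computes
per_n over ℂ. Wires
(`edgeSize`), not gates, are counted, because the gate count leaves the product fan-in — the degree
D of the Chow variety
below — uncharged. X is attacked through its border/padded strengthening ChowBorderBound
(Landsberg2017 Cor. 7.5.3.3):
x_0^(D−n)·per_n ∉ σ_r(Ch_D(ℂ^(n²+1))) whenever r, D ≤ (n+2)^(c√n+c), written in ε-algebra (Σ_{i<r}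
Π_{j<D} ℓ_ij(ε) =
ε^q·per_n + ε^(q+1)·G with affine ℓ_ij over ℂ[ε]). Realises card borel-fixed-chow-depth3 (statement
side verbatim; its
scheme-level mechanism is filed in corrected, smoothable form as informal cruxes, see Why this line
/ Barriers).
Lean: `∀ c : ℕ, ∃ n : ℕ, ∀ P : Literature.Computability.AlgebraicComplexity.ArithCircuit ℂ (Fin n ×
Fin n), P.Computes (Literature.Computability.AlgebraicComplexity.perPoly (Fin n) ℂ) → P.productDepth
≤ 1 → (n + 2) ^ (c * Nat.sqrt n + c) < P.edgeSize`

## Assembly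
Pure bookkeeping (sorry-free in Sketch.lean): were VP = VNP, the permanent family would be a VP
family (renaming bridge +
Valiant's per ∈ VNP), Depth3Chasm would give c and circuits of product-depth ≤ 1 with ≤
(n+2)^(c⌊√n⌋+c) wires for every n
(deg per_n = n), contradicting Depth3Thesis at that c. The degree identity, the bridge
`mem_VP_ofFintype_iff` and
`perFamily_mem_VNP` are existing Literature facts, inlined as hypotheses exactly as in route Depth4.

Rationale: WHY THIS LINE. By the depth-3 chasm (GuptaKamathKayalSaptharishi2016 Thm 1.1 with Tavenas2015;
Landsberg2017 Thm 7.5.2.1, Cor 7.5.3.3) every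
VP family over ℂ has ΣΠΣ circuits with (n+2)^(O(√deg)) wires, so an n^(ω(√n)) wire bound for per_n
gives VP ≠ VNP; no route
holds this target yet (Depth4 is product-depth 2). The card's import from algebraic geometry is
Buczyńska–Buczyński border
apolarity with torus-fixed witnesses (BuczynskaBuczynski2021, ConnerHarperLandsberg2023) pointed at
secants of the Chow variety,
using the 2n-dimensional torus of the padded permanent. Planner analysis at filing sharpened the
card in three ways that shape
the cruxes: (i) border Chow decompositions of a homogeneous target admit a LOCAL normal form at the
vertex x_0^D, where a product
of affine forms is exp(Σ_k (−1)^(k+1) p_k/k) of the power sums of its linear parts — two summands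
linearise by a logarithm to
border Waring rank (support LocalFanInTwo, exponential and provable now), polynomially many summands
are the first open rung
(PolyFanInLocal), beyond the constant-fan-in de-bordering of doi:10.1109/focs52979.2021.00018; (ii)
scheme-level witnesses
must be SMOOTHABLE: the Zariski tangent space of Ch_D at x_0^D is all of S^D V, so every padded form
lies in the span of a
B-stable length-2 subscheme at the vertex, and ambient weak border apolarity is capped at 2
(Buczynski2026 cactus barrier bites
maximally); (iii) the torus-fixing step is not given by BB's theorem (ideals, not spans) and is
filed as its own crux.

RANKED CRUXES. #0 Depth3Thesis (target) — for every c some n admits no product-depth-≤1 circuit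
computing per_n over ℂ with at most (n+2)^(c⌊√n⌋+c) wires. (why it might fail: false if per_n has
ΣΠΣ circuits with n^(O(√n)) wires (a GKKS-type duality-trick circuit for per, i.e. a 2^(O(√n log n))
depth-3 formula); only n^(Ω(√log n))-type ΣΠΣ bounds are known for per_n over ℂ (LST 2021 via IMM).)
[GuptaKamathKayalSaptharishi2016, Tavenas2015, Landsberg2017, LimayeSrinivasanTavenas2021]
#2 Depth3Chasm (crux) — depth-3 chasm in the tree's model (unvendored named fact, filed FIRST):
every VP family f over ℂ has, for some c and all n, a product-depth-≤1 circuit computing f_n with at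
most (n+2)^(c⌊√(deg f_n)⌋+c) wires (GKKS 2016 Thm 1.1 via Tavenas 2015: ΣΠΣ size 2^(O(√(d log(ds)
log N)))). [difficulty: L] (why it might fail: transcription risk only: the printed ΣΠΣ bound must
be re-derived with wires counted and small-n / degree-0,1 cases absorbed by (n+2)^c; the duality
trick needs ℂ (univariate factoring), which the summit's field provides.)
[GuptaKamathKayalSaptharishi2016, Tavenas2015, Landsberg2017]
#3 ChowBorderBound (crux) — for every c, for all large n and all r, D ≤ (n+2)^(c⌊√n⌋+c), the padded
permanent x_0^(D−n)per_n is not in σ_r(Ch_D(ℂ^(n²+1))): no q, no r·D affine forms ℓ_ij over ℂ[ε] and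
no G with Σ_i Π_j ℓ_ij = ε^q·per_n + ε^(q+1)·G (Landsberg2017 Cor 7.5.3.3 hypothesis; card item 3 in
border form). [difficulty: open-problem] (why it might fail: border depth 3 is far stronger than
depth 3 (Kumar 2020: top fan-in 2 suffices for EVERY form once D ≥ deg·Waring rank), so padded per
may have border Chow rank n^(O(√n)) in the chasm range even if Depth3Thesis holds; no technique
beyond flattenings, which padding defeats.) [Landsberg2017, doi:10.1145/3371506,
GuptaKamathKayalSaptharishi2016, arXiv:1510.00886]
#4 PolyFanInLocal (crux) — local normal form with polynomial top fan-in: for every k, c, all large n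
and all r ≤ n^k+k, D ≤ (n+2)^(c⌊√n⌋+c), there is no border expression Σ_{i<r} a_i(ε)·Π_{j<D}(1 +
m_ij(ε)) = ε^q·per_n + ε^(q+1)·G with linear forms m_ij whose coefficients are divisible by ε (all
D·r affine factors degenerate to constants: sums of r exponentials of power-sum curves).
[difficulty: XL] (why it might fail: two summands linearise (log) to border Waring rank, three or
more do not: cancellations c(e^(L+εA) − e^L)/ε → A·e^L create product structure; de-bordering of
Σ^[k]ΠΣ (Dutta–Dwivedi–Saxena 2021) is exponential in k and silent for k = poly(n).)
[doi:10.1109/focs52979.2021.00018, doi:10.1145/3838180, doi:10.1145/3371506, Shpilka2002]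
#9 LocalFanInTwo (support) — a two-summand local border expression a_1(ε)Π_j(1+m_1j) − … = ε^q per_n
+ ε^(q+1)G with ε ∣ m_ij and D factors forces C(n,⌊n/2⌋)² ≤ 2D: taking logarithms, p_n(m_1) −
p_n(m_2) degenerates to a multiple of per_n, so border Waring rank(per_n) ≤ 2D, and the middle
catalecticant of per_n has rank C(n,⌊n/2⌋)². [difficulty: M] [doi:10.1145/3371506, Landsberg2017,
NisanWigderson1996]
#9 SPSNormalForm (support) — glue: a product-depth-≤1 circuit with E wires computing per_n gives
per_n = Σ_{i≤E} Π_{j≤E} ℓ_ij with affine ℓ_ij over ℂ (depth-0 gates compute affine forms; forward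
references evaluate to 0; pad with factors 1 and summands 0). [difficulty: provable-now]
[Landsberg2017, BurgisserClausenShokrollahi1997]
#9 ChowToThesis (support) — glue: ChowBorderBound and SPSNormalForm imply Depth3Thesis (take c+1 in
ChowBorderBound, embed the exact expression with q = 0 over ℂ[ε]; sorry-free in the planner's
Sketch.lean). [difficulty: provable-now] [Landsberg2017]

TWO-LAYER PLAN. Foreseen glued splits, filed only when a crux closes: ChowBorderBound ⇐
BSymmetrisation → BStableWitnessBound → ChowBorderBound
(the card's mechanism: torus-fixing of smoothable witnesses, then a length bound for B-stable
smoothable schemes at monomial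
points; both filed now as informal cruxes of this route); BStableWitnessBound ⇐ vertex case (support
x_0^D) → general monomial
support; PolyFanInLocal ⇐ fan-in 3 → fan-in n^k.

KILL CRITERIA. A border expression Σ_{i<r}Π_{j<D} ℓ_ij(ε) = ε^q per_n + O(ε^(q+1)) with r·D =
n^(O(√n)) (e.g. a GKKS duality-trick circuit
transplanted to the permanent, or a Kumar-type border trick with quasi-polynomial degree) refutes
ChowBorderBound: close
`refuted:ChowBorderBound` unless it is genuinely border (q ≥ 1 essential), in which case pivot to
the non-border Depth3Thesis with
a measure-based line. A poly-fan-in local expression refutes PolyFanInLocal and ChowBorderBound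
together. An honest ΣΠΣ circuit
with n^(O(√n)) wires for per_n refutes Depth3Thesis and closes the route. If BSymmetrisation is
refuted (a witness configuration
whose every torus degeneration drops the permanent from the span), the card's mechanism is dead but
ChowBorderBound survives
as a target for other engines. Depth4Thesis or any other route proving per ∉ VP moots the route.

NOT DECOMPOSED YET. The torus-fixing lemma and the B-stable length bound (informal cruxes, no Lean
signature until Hilbert schemes of points on
Ch_D are available); the vertex-versus-general-monomial split of the length bound; uniformity in D
inside the length bound;
the Segre-lift (ideal-level, Cox ring of (PV)^×D with S_D symmetry) variant of border apolarity; the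
fan-in-3 case of
PolyFanInLocal; the calibration n = 3, 4 (exact border Chow rank of x_0^(D−3)per_3 for D ≤ 6).

CHEAPEST FALSIFIER. Computer algebra at n = 3: search for border expressions Σ_{i<r}Π_{j<D}ℓ_ij(ε) ≡
ε^q per_3 with small (r, D), in particular
poly-fan-in LOCAL ones (r = 3, 4; D ≤ 12) — a hit pattern that visibly scales (like Kumar's
Π(1+εℓ^d) trick but with
quasi-polynomial D) kills PolyFanInLocal and ChowBorderBound. Lookup already done by the planner:
for r ≤ 2 local summands the
answer is NO below D = C(n,⌊n/2⌋)²/2 (LocalFanInTwo), and WITHOUT smoothability every padded form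
has a length-2 witness at
the vertex (so refuters should not spend time on non-smoothable scheme witnesses: they always
exist).

NUMBERS. Chasm: VP ⇒ ΣΠΣ size 2^(O(√(d log(ds) log N))) = (n+2)^(O(√d)) (Tavenas2015; Landsberg2017
Thm 7.5.2.1); [ℓ^(n−m)det_m] ∈
σ_r(Ch_n(ℂ^(m²+1))) with rn = 2^(O(√m log m)) (Landsberg2017 Cor 7.5.3.2). Ryser: per_n = t^(−n) Σ_S
± Π_i(1 + tΣ_{j∈S}x_ij)
exactly, 2^n local summands of degree n. Homogeneous ΣΠΣ for per_n, det_n: ≥ 2^n/n … 2^n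
(NisanWigderson1996; Landsberg2017 Prop
7.2.2.1). Border top fan-in 2 suffices for every degree-d form once D ≥ d·(Waring rank)
(doi:10.1145/3371506); conversely two
LOCAL summands need 2D ≥ C(n,⌊n/2⌋)² ≈ 4^n/(πn/2) for per_n. Symmetric model (one e_d of D forms,
exact): only linear lower
bounds known (Shpilka2002). Best ΣΠΣ lower bound for per_n over ℂ: n^(Ω(√log n)) via IMM
(LimayeSrinivasanTavenas2021).
Items at open: 9 typed (target, 3 cruxes, 3 support, assembly) + 2 informal cruxes filed after open.

DEFINITION REQUESTS. None blocking. The ε-algebra border predicate is inlined in each item (no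
shared `BorderSPS` definition) so that every item
elaborates today; if a grounder prefers, a definition item `BorderSigmaPiSigma n r D` under
Summits/ValiantsHypothesis/ValiantsHypothesis/Theorems can replace the inlined ∃-blocks later. The
informal cruxes need Hilbert
schemes of points / torus-stable subschemes of Ch_D, far from Mathlib; they stay informal.

Novelty: Searches (2026-08-15): card's own audit searches (zbMATH ×4 'border apolarity', Chow secants, Young
flattenings; frontier 30
rows); planner: `lit search --source crossref` ×4 (Shpilka 2002 doi:10.1016/s0022-0000(02)00021-1
READ pp.1–4; Shpilka 2026
doi:10.1007/s00037-026-00286-x READ pp.1–6; DDS 2021 doi:10.1109/focs52979.2021.00018; Dutta–Saxena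
doi:10.1145/3838180;
Kumar 2020 doi:10.1145/3371506), `lit read book:landsberg2017-geometry-complexity-theory`
pp.184–190, 202–205 (Prop 7.2.1.1,
7.2.3.4, Thm 7.5.2.1, Cor 7.5.3.2–7.5.3.3, Rem 7.5.3.7), `lit galaxy search "affine projections of
symmetric polynomials" --star
all` (0 rows, pdf/crabby stars timed out), `lean search` chasm/ΣΠΣ/productDepthCircuitSize 1
(depth-3 chasm not vendored);
local searchd and OpenAlex/S2/arXiv were down or rate-limited (HTTP 429) at filing.
Nearest prior art found: Landsberg2017 Cor 7.5.3.3 (= the target ChowBorderBound verbatim, after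
GuptaKamathKayalSaptharishi2016);
BuczynskaBuczynski2021 + ConnerHarperLandsberg2023 (Borel-fixed border apolarity, Segre/Veronese
only); doi:10.1145/3371506 and
doi:10.1109/focs52979.2021.00018 (border depth 3 with bounded top fan-in: universality and
de-bordering); Shpilka2002 (symmetric
model = one local summand, linear bounds).
Delta: the vertex normal form (products of affine forms as exponentials of power-sum curves) turning
border Chow rank of the
padded permanent into sums of r exponentials, with the r ≤ 2 case settled by a logarithm +
catalecticants and the  [refs: 10.1016/s0022-0000(02, 10.1007/s00037-026-00286-x, 10.1109/focs52979.2021.00018, 10.1145/3838180, 10.1145/3371506, doi:10.1016/s0022-0000, doi:10.1007/s00037-026-00286-x, doi:10.1109/focs52979.2021.00018, doi:10.1145/3838180, doi:10.1145/3371506, book:landsberg2017-geometry-complexity-theory, Landsberg2017, GuptaKamathKayalSaptharishi2016, BuczynskaBuczynski2021, ConnerHarperLandsberg2023, Shpilka]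

Barriers (technique_class: border-apolarity, chow-secants, depth-three): - technique_class: border-apolarity, chow-secants, depth-three
- Literature.Barriers.ValiantsHypothesis.DepthReductionChasm: formalises that VP-saturated
ΣΠΣΠ-sound MEASURES stop at (n+2)^(c√n+c); its depth-3 analogue applies to any measure-based proof
of Depth3Thesis (det/IMM saturate the depth-3 chasm, Landsberg2017 Cor 7.5.3.2). This line is a
witness/normal-form method, not a sub-additive measure, and its cruxes are specific to per (torus
weight (1,…,1)); honest status: it must distinguish per from det inside the same weight space, and
nothing filed yet does.
- Literature.Barriers.ValiantsHypothesis.DepthReductionChasmDepthFour: same remark; the route works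
at product-depth 1, where the printed chasm (GKKS 2016) is the relevant ceiling for saturated
measures, not evaded but sidestepped by not using a measure.
- Literature.Barriers.ValiantsHypothesis.PartialDerivativesDetPerm: flattenings/partial-derivative
ranks of per and det coincide and, for the padded permanent, lose the factor C(D,k); rank methods
therefore cannot reach ChowBorderBound and are used here only at the vertex after the logarithm
(LocalFanInTwo, no padding loss). The cactus barrier of Buczynski2026 applies with full force to
scheme/ideal witnesses in the ambient ring of P(S^D V): cap = 2 (vertex tangent space) — the bet is
that SMOOTHABILITY of torus-stable schemes, which the cap does not constrain, can be controlled; it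
does not evade the barrier otherwise.
- Literature.Barriers.ValiantsHypothesis.GCTUse

History (route lifecycle, newest last):
- 2026-08-16T04:20:00Z · AUTO-CRUX (backfill): Depth3Thesis — hypotheses of the deciding theorem that nothing in the route derives are cruxes (operator:999:1085951)
- 2026-08-24T10:53:24Z · DORMANT — reconciler: no traction for 6.7 d (last activity item-evidence-added at 2026-08-17T17:02:31Z); parked, not closed — `ledger route dormant route-ValiantsHypothes (operator:999:53431)

sub-problem: ValiantsHypothesis · status: dormant · opened planner-plancard-ValiantsHypothesis-ValiantsH-d7ee7d80-0 2026-08-15T11:43:34Z · rev 1 · ledger route-ValiantsHypothesis-ChowBorderDepth3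
GENERATED by the gate from the ledger (D-0016/17). Provers cite these decls: `theorem foo : Summit.ValiantsHypothesis.ValiantsHypothesis.Theses.ChowBorderDepth3.<Decl> := …` in Summits/ValiantsHypothesis/ValiantsHypothesis/Theorems/<Name>.lean.
-/

namespace Summit.ValiantsHypothesis.ValiantsHypothesis.Theses.ChowBorderDepth3

open scoped BigOperators Topology Manifold Classical MeasureTheory ProbabilityTheory Matrix InnerProductSpace ComplexConjugate ContinuousMap
open Filter Set Function TopologicalSpace MeasureTheory

attribute [summit_statement] _root_.ValiantsHypothesis

open Literature.PNP

/-- item stmt-ValiantsHypothesis-5934 · crux (kind.auto-crux: conjecture-grade) · rank 0 · open · by planner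
why it might fail: false if per_n has ΣΠΣ circuits with n^(O(√n)) wires (a GKKS-type duality-trick circuit for per, i.e. a 2^(O(√n log n)) depth-3 formula); only n^(Ω(√log n))-type ΣΠΣ bounds are known for per_n over ℂ (LST 2021 via IMM).
sources: GuptaKamathKayalSaptharishi2016, Tavenas2015, Landsberg2017, LimayeSrinivasanTavenas2021
[target] for every c some n admits no product-depth-≤1 circuit computing per_n over ℂ with at most
(n+2)^(c⌊√n⌋+c) wires. -/
@[route_item "route-ValiantsHypothesis-ChowBorderDepth3", crux]
def Depth3Thesis : Prop :=
  ∀ c : ℕ, ∃ n : ℕ, ∀ P : Literature.Computability.AlgebraicComplexity.ArithCircuit ℂ (Fin n × Fin n), P.Computes (Literature.Computability.AlgebraicComplexity.perPoly (Fin n) ℂ) → P.productDepth ≤ 1 → (n + 2) ^ (c * Nat.sqrt n + c) < P.edgeSize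

/-- item stmt-ValiantsHypothesis-5935 · crux · rank 2 · closed · proved by Summit.ValiantsHypothesis.ValiantsHypothesis.Theorems.ChowBorderDepth3Depth3Chasm.depth3Chasm_proof @ a57bb1e1b009 (prover) · by planner
why it might fail: transcription risk only: the printed ΣΠΣ bound must be re-derived with wires counted and small-n / degree-0,1 cases absorbed by (n+2)^c; the duality trick needs ℂ (univariate factoring), which the summit's field provides.
sources: GuptaKamathKayalSaptharishi2016, Tavenas2015, Landsberg2017
[crux] depth-3 chasm in the tree's model (unvendored named fact, filed FIRST): every VP family f
over ℂ has, for some c and all n, a product-depth-≤1 circuit computing f_n with at most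
(n+2)^(c⌊√(deg f_n)⌋+c) wires (GKKS 2016 Thm 1.1 via Tavenas 2015: ΣΠΣ size 2^(O(√(d log(ds) log
N)))). [difficulty: L] -/
@[route_item "route-ValiantsHypothesis-ChowBorderDepth3", crux]
def Depth3Chasm : Prop :=
  ∀ {σ : ℕ → Type} [∀ n, Fintype (σ n)] (f : ∀ n, MvPolynomial (σ n) ℂ), Literature.Computability.AlgebraicComplexity.IsVPFamily f → ∃ c : ℕ, ∀ n : ℕ, ∃ P : Literature.Computability.AlgebraicComplexity.ArithCircuit ℂ (σ n), P.Computes (f n) ∧ P.productDepth ≤ 1 ∧ P.edgeSize ≤ (n + 2) ^ (c * Nat.sqrt ((f n).totalDegree) + c)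

/-- item stmt-ValiantsHypothesis-5936 · crux · rank 3 · open · by planner
why it might fail: border depth 3 is far stronger than depth 3 (Kumar 2020: top fan-in 2 suffices for EVERY form once D ≥ deg·Waring rank), so padded per may have border Chow rank n^(O(√n)) in the chasm range even if Depth3Thesis holds; no technique beyond flattenings, which padding defeats.
sources: Landsberg2017, doi:10.1145/3371506, GuptaKamathKayalSaptharishi2016, arXiv:1510.00886
[crux] for every c, for all large n and all r, D ≤ (n+2)^(c⌊√n⌋+c), the padded permanent
x_0^(D−n)per_n is not in σ_r(Ch_D(ℂ^(n²+1))): no q, no r·D affine forms ℓ_ij over ℂ[ε] and no G with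
Σ_i Π_j ℓ_ij = ε^q·per_n + ε^(q+1)·G (Landsberg2017 Cor 7.5.3.3 hypothesis; card item 3 in border
form). [difficulty: open-problem] -/
@[route_item "route-ValiantsHypothesis-ChowBorderDepth3", crux]
def ChowBorderBound : Prop :=
  ∀ c : ℕ, ∃ n₀ : ℕ, ∀ n ≥ n₀, ∀ r D : ℕ, r ≤ (n + 2) ^ (c * Nat.sqrt n + c) → D ≤ (n + 2) ^ (c * Nat.sqrt n + c) → ¬ ∃ (q : ℕ) (ℓ : Fin r → Fin D → MvPolynomial (Fin n × Fin n) (Polynomial ℂ)) (G : MvPolynomial (Fin n × Fin n) (Polynomial ℂ)), (∀ i j, (ℓ i j).totalDegree ≤ 1) ∧ (∑ i, ∏ j, ℓ i j) = MvPolynomial.C (Polynomial.X ^ q) * MvPolynomial.map Polynomial.C (Literature.Computability.AlgebraicComplexity.perPoly (Fin n) ℂ) + MvPolynomial.C (Polynomial.X ^ (q + 1)) * G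

/-- item stmt-ValiantsHypothesis-5937 · crux · rank 4 · open · by planner
why it might fail: two summands linearise (log) to border Waring rank, three or more do not: cancellations c(e^(L+εA) − e^L)/ε → A·e^L create product structure; de-bordering of Σ^[k]ΠΣ (Dutta–Dwivedi–Saxena 2021) is exponential in k and silent for k = poly(n).
sources: doi:10.1109/focs52979.2021.00018, doi:10.1145/3838180, doi:10.1145/3371506, Shpilka2002
[crux] local normal form with polynomial top fan-in: for every k, c, all large n and all r ≤ n^k+k,
D ≤ (n+2)^(c⌊√n⌋+c), there is no border expression Σ_{i<r} a_i(ε)·Π_{j<D}(1 + m_ij(ε)) = ε^q·per_n +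
ε^(q+1)·G with linear forms m_ij whose coefficients are divisible by ε (all D·r affine factors
degenerate to constants: sums of r exponentials of power-sum curves). [difficulty: XL] -/
@[route_item "route-ValiantsHypothesis-ChowBorderDepth3", crux]
def PolyFanInLocal : Prop :=
  ∀ k c : ℕ, ∃ n₀ : ℕ, ∀ n ≥ n₀, ∀ r D : ℕ, r ≤ n ^ k + k → D ≤ (n + 2) ^ (c * Nat.sqrt n + c) → ¬ ∃ (q : ℕ) (a : Fin r → Polynomial ℂ) (m : Fin r → Fin D → (Fin n × Fin n) → Polynomial ℂ) (G : MvPolynomial (Fin n × Fin n) (Polynomial ℂ)), (∀ i j v, Polynomial.X ∣ m i j v) ∧ (∑ i, MvPolynomial.C (a i) * ∏ j, (1 + ∑ v, MvPolynomial.C (m i j v) * MvPolynomial.X v)) = MvPolynomial.C (Polynomial.X ^ q) * MvPolynomial.map Polynomial.C (Literature.Computability.AlgebraicComplexity.perPoly (Fin n) ℂ) + MvPolynomial.C (Polynomial.X ^ (q + 1)) * G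

-- item stmt-ValiantsHypothesis-6916 · support · rank 5 · open · by planner — informal only, no Lean statement yet:
--   [crux] For every c, all large n and all r, D ≤ (n+2)^(c⌊√n⌋+c): no zero-dimensional subscheme Z ⊂
--   Ch_D(ℂ^(n²+1)) of length r that is (i) stable under the torus B (x_0 ↦ γx_0, x_ij ↦ α_i β_j x_ij),
--   hence supported at monomial points, and (ii) SMOOTHABLE IN Ch_D (in the closure of the locus of r
--   distinct points in Hilb_r(Ch_D)), has the padded permanent x_0^(D−n)·per_n in its projective span
--   ⟨Z⟩. First rung: Z supported at the single vertex x_0^D ('torus-symmetric Ryser is optimal in the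
--   chasm range'). Necessary special case of ChowBorderBound (such a Z puts the padded permanent in
--   σ_r(Ch_D)); w

-- item stmt-ValiantsHypothesis-6922 · support · rank 6 · open · by planner — informal only, no Lean statement yet:
--   [crux] Torus-fixing without span loss for Chow secants (card borel-fixed-chow-depth3, item 2,
--   corrected): if F = x_0^(D−n)·per_n lies in σ_r(Ch_D(ℂ^(n²+1))) (n ≥ 3, D ≥ n, any r), then there is
--   a zero-dimensional subscheme Z ⊂ Ch_D of length ≤ r, stable under the torus B (x_0 ↦ γx_0, x_ij ↦
--   α_i β_j x_ij), smoothable in Ch_D, with F ∈ ⟨Z⟩ (span-exact, not merely F in the limit of spans).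
--   Together with BStableWitnessBound this yields ChowBorderBound — the card's two-step mechanism. WHY
--   IT MIGHT FAIL: Buczyńska–Buczyński border apolarity (smooth projective TORIC X, arXiv:1910.01944 Thm
--   1.2) yield

/-- item stmt-ValiantsHypothesis-5938 · support · rank 9 · closed · proved by Summit.ValiantsHypothesis.ValiantsHypothesis.Theorems.ChowBorderDepth3LocalFanInTwo.localFanInTwo_proof @ 1f1983e0c021 (prover) · by planner
sources: doi:10.1145/3371506, Landsberg2017, NisanWigderson1996
[support] a two-summand local border expression a_1(ε)Π_j(1+m_1j) − … = ε^q per_n + ε^(q+1)G with ε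
∣ m_ij and D factors forces C(n,⌊n/2⌋)² ≤ 2D: taking logarithms, p_n(m_1) − p_n(m_2) degenerates to
a multiple of per_n, so border Waring rank(per_n) ≤ 2D, and the middle catalecticant of per_n has
rank C(n,⌊n/2⌋)². [difficulty: M] -/
@[route_item "route-ValiantsHypothesis-ChowBorderDepth3", crux]
def LocalFanInTwo : Prop :=
  ∀ (n D q : ℕ) (a : Fin 2 → Polynomial ℂ) (m : Fin 2 → Fin D → (Fin n × Fin n) → Polynomial ℂ) (G : MvPolynomial (Fin n × Fin n) (Polynomial ℂ)), 1 ≤ n → (∀ i j v, Polynomial.X ∣ m i j v) → (∑ i, MvPolynomial.C (a i) * ∏ j, (1 + ∑ v, MvPolynomial.C (m i j v) * MvPolynomial.X v)) = MvPolynomial.C (Polynomial.X ^ q) * MvPolynomial.map Polynomial.C (Literature.Computability.AlgebraicComplexity.perPoly (Fin n) ℂ) + MvPolynomial.C (Polynomial.X ^ (q + 1)) * G → (n.choose (n / 2)) ^ 2 ≤ 2 * D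

/-- item stmt-ValiantsHypothesis-5939 · support · rank 9 · closed · proved by Summit.ValiantsHypothesis.ValiantsHypothesis.Theorems.SPSNormalForm_proof @ 34198bccdf3d (prover) · by planner
sources: Landsberg2017, BurgisserClausenShokrollahi1997
[support] glue: a product-depth-≤1 circuit with E wires computing per_n gives per_n = Σ_{i≤E}
Π_{j≤E} ℓ_ij with affine ℓ_ij over ℂ (depth-0 gates compute affine forms; forward references
evaluate to 0; pad with factors 1 and summands 0). [difficulty: provable-now] -/
@[route_item "route-ValiantsHypothesis-ChowBorderDepth3", crux]
def SPSNormalForm : Prop :=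
  ∀ (n : ℕ) (P : Literature.Computability.AlgebraicComplexity.ArithCircuit ℂ (Fin n × Fin n)), P.Computes (Literature.Computability.AlgebraicComplexity.perPoly (Fin n) ℂ) → P.productDepth ≤ 1 → ∃ (ℓ : Fin (P.edgeSize + 1) → Fin (P.edgeSize + 1) → MvPolynomial (Fin n × Fin n) ℂ), (∀ i j, (ℓ i j).totalDegree ≤ 1) ∧ (∑ i, ∏ j, ℓ i j) = Literature.Computability.AlgebraicComplexity.perPoly (Fin n) ℂ

/-- item stmt-ValiantsHypothesis-5940 · support · rank 9 · closed · proved by Summit.ValiantsHypothesis.ValiantsHypothesis.Theorems.chowToThesis_proof @ f4d157d9ab70 (prover) · by planner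
sources: Landsberg2017
[support] glue: ChowBorderBound and SPSNormalForm imply Depth3Thesis (take c+1 in ChowBorderBound,
embed the exact expression with q = 0 over ℂ[ε]; sorry-free in the planner's Sketch.lean).
[difficulty: provable-now] -/
@[route_item "route-ValiantsHypothesis-ChowBorderDepth3", crux]
def ChowToThesis : Prop :=
  ChowBorderBound → SPSNormalForm → Depth3Thesis

/-- item stmt-ValiantsHypothesis-5941 · assembly · rank 1 · closed · proved by Summit.ValiantsHypothesis.ValiantsHypothesis.Theorems.chowBorderDepth3_assembly_proof (prover) · by planner
sources: GuptaKamathKayalSaptharishi2016, Valiant1979, BurgisserClausenShokrollahi1997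
[assembly] Depth3Chasm → Depth3Thesis → (deg per_n = n) → (perFamily ∈ VP ↔ IsVPFamily per) → per ∈
VNP → ValiantsHypothesis. -/
@[route_item "route-ValiantsHypothesis-ChowBorderDepth3", crux]
def Assembly : Prop :=
  Depth3Chasm → Depth3Thesis → (∀ n : ℕ, (Literature.Computability.AlgebraicComplexity.perPoly (Fin n) ℂ).totalDegree = n) → (Literature.Computability.AlgebraicComplexity.perFamily ℂ ∈ Literature.Computability.AlgebraicComplexity.VP ℂ ↔ Literature.Computability.AlgebraicComplexity.IsVPFamily (fun n => Literature.Computability.AlgebraicComplexity.perPoly (Fin n) ℂ)) → Literature.Computability.AlgebraicComplexity.perFamily_mem_VNP ℂ → ValiantsHypothesis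

/-! D-0027 §2.1 — DECIDING THEOREM (planner-authored via `route open/edit --closes-file`; by planner-rbadge-ValiantsHypothesis-ChowBorderDe-17d677fd-g2-0 2026-08-15T16:14:26Z):
its hypotheses are this route's items and its conclusion the sub-problem Statement (glue_lint), and it elaborates with this file. -/

@[closes "route-ValiantsHypothesis-ChowBorderDepth3"] theorem closes : Depth3Thesis → Depth3Chasm → ChowBorderBound → PolyFanInLocal → LocalFanInTwo → SPSNormalForm → ChowToThesis → Assembly → _root_.ValiantsHypothesis := by
  intro hX hChasm _hChow _hPoly _hTwo _hNF _hCT _hAsm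
  show Literature.Computability.AlgebraicComplexity.VP ℂ ≠ Literature.Computability.AlgebraicComplexity.VNP ℂ
  intro hEq
  -- per ∈ VNP = VP (Valiant 1979: `perFamily_mem_VNP_holds`), so the permanent is a VP family (renaming bridge)
  have hper : Literature.Computability.AlgebraicComplexity.perFamily ℂ ∈ Literature.Computability.AlgebraicComplexity.VP ℂ := by
    rw [hEq]; exact Literature.Computability.AlgebraicComplexity.perFamily_mem_VNP_holds ℂ
  have hVP : Literature.Computability.AlgebraicComplexity.IsVPFamily
      (fun n => Literature.Computability.AlgebraicComplexity.perPoly (Fin n) ℂ) :=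
    (Literature.Computability.AlgebraicComplexity.mem_VP_ofFintype_iff_holds
      (fun n => Literature.Computability.AlgebraicComplexity.perPoly (Fin n) ℂ)).1 hper
  -- the depth-3 chasm gives one `c` and, for every `n`, a product-depth-≤1 circuit with few wires
  obtain ⟨c, hc⟩ := hChasm (fun n => Literature.Computability.AlgebraicComplexity.perPoly (Fin n) ℂ) hVP
  -- the thesis refuses that `c` at some `n`
  obtain ⟨n, hn⟩ := hX c
  obtain ⟨P, hP, hdepth, hsize⟩ := hc n
  have hdeg : (Literature.Computability.AlgebraicComplexity.perPoly (Fin n) ℂ).totalDegree = n := by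
    rw [Literature.Computability.AlgebraicComplexity.totalDegree_perPoly_holds (n := Fin n) (k := ℂ), Fintype.card_fin]
  rw [hdeg] at hsize
  exact absurd (lt_of_lt_of_le (hn P hP hdepth) hsize) (lt_irrefl _)

end Summit.ValiantsHypothesis.ValiantsHypothesis.Theses.ChowBorderDepth3
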